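import Literature.NumberTheory.PAdicHodge.CompletedAlgClosure
import Literature.NumberTheory.GaloisRepresentations.PadicAlgebraOfLocalField
import Mathlib.Analysis.Normed.Module.FiniteDimension
import Mathlib.NumberTheory.Padics.ProperSpace
import HarnessLib

/-!
# The base field `K₀ = ℚ_p ⊆ F` of a `p`-adic local field, with the absolute value of `F`

Let `F` be a non-archimedean local field of characteristic `0` and residue characteristic `p`
(`hp : valuation F p < 1`), `ι = LocalField.padicRingHom F p hp : ℚ_[p] →+* F` the canonical
embedding (`Literature/NumberTheory/GaloisRepresentations/PadicAlgebraOfLocalField`; Serre,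
*Local Fields* II §5). Tate–Sen theory over `F` (Tate 1967, §3; Fontaine–Ouyang §3.1) works with
the cyclotomic tower of the BASE FIELD `ℚ_p` inside `F̄` and with the Galois group of `F̄` over
`ℚ_p`; for the analytic arguments `ℚ_p` has to carry the restriction of THE absolute value of `F`
(`IsNonarchimedeanLocalField.nontriviallyNormedField F`, an arbitrary rank-one normalisation —
in general NOT Mathlib's `‖·‖` on `ℚ_[p]`, which is `|·|_p`; the two differ by an exponent).

This file provides that base field as a normed field:

* `PadicBase F p hp` — a TYPE SYNONYM for `ℚ_[p]` carrying the normed field structure INDUCED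
  from `F` through `ι` (`‖x‖ = ‖ι x‖_F`, `PadicBase.norm_def`), so that `ι = algebraMap K₀ F` is an
  isometry (`norm_algebraMap`, `isometry_algebraMap`); it is nontrivially normed (`‖p‖ < 1`),
  ultrametric and COMPLETE (`instCompleteSpace`: `ι(ℚ_p) = ⋃ₙ p⁻ⁿ ι(ℤ_p)` is closed in `F`,
  `isClosed_range_algebraMap`, `ι(ℤ_p)` being compact);
* the value group: `‖x‖ = ‖p‖ ^ v_p(x)` (`norm_eq_norm_p_zpow`), units of `ℤ_p` have norm `1`;
* the algebra structures `K₀ → F → F̄ = NormedAlgClosure F` (`instAlgebra`, `instAlgebraClosure`,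
  scalar tower), `FiniteDimensional K₀ F` (a locally compact space over a complete field,
  Mathlib `FiniteDimensional.of_locallyCompactSpace`; Serre II §5 / Neukirch II (5.2): local
  fields of characteristic `0` are the finite extensions of `ℚ_p`), hence `F̄/K₀` is algebraic and
  `F̄` is an algebraic closure of `K₀` (`instIsAlgClosureClosure`), in particular normal.

Everything is elementary; the point is to fix ONE normed avatar of `ℚ_p ⊆ F` for the files
`BaseGaloisAction`, `AxSenTateBase`, `CyclotomicTowerNorms`, `TateNormalizedTrace`,
`TateTwistInvariants` (Tate's theorem `H⁰(Γ_F, ℂ_F(χ^j)) = 0`, `j ≠ 0`).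

## References

* J.-P. Serre, *Local Fields* (GTM 67), Ch. II §5. [SerreLocalFields1979]
* J. Neukirch, *Algebraic Number Theory*, Ch. II (5.2). [NeukirchANT1999]
* J. Tate, *p-divisible groups* (1967), §3.1 (the fields `K ⊇ ℚ_p`, `C`). [Tate1967]
-/

noncomputable section

open ValuativeRel Field UniformSpace Filter Topology

namespace Literature.NumberTheory.PAdicHodge

open Literature.NumberTheory.GaloisRepresentations
open Literature.NumberTheory.GaloisRepresentations.IsNonarchimedeanLocalField

variable (F : Type) [Field F] [ValuativeRel F] [TopologicalSpace F] [IsNonarchimedeanLocalField F]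
  [CharZero F] (p : ℕ) [Fact p.Prime]

/-- **The base field `K₀ = ℚ_p` of `F`, normed by `F`**: a type synonym for `ℚ_[p]` which carries
the absolute value induced from `F` through the canonical embedding
`LocalField.padicRingHom F p hp : ℚ_[p] →+* F` (declared below, before any other structure).
[cite: SerreLocalFields1979, Ch. II §5] -/
@[nolint unusedArguments]
def PadicBase (_hp : valuation F p < 1) : Type := ℚ_[p]

namespace PadicBase

variable {F p} (hp : valuation F p < 1)

/-- `K₀` is a field (the field structure of `ℚ_[p]`). [folklore] -/
instance instField : Field (PadicBase F p hp) := inferInstanceAs (Field ℚ_[p])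

/-- `K₀` has characteristic `0`. [folklore] -/
instance instCharZero : CharZero (PadicBase F p hp) := inferInstanceAs (CharZero ℚ_[p])

/-- The identification `K₀ = ℚ_[p]` as a ring isomorphism (the identity). [folklore] -/
def toPadic : PadicBase F p hp ≃+* ℚ_[p] := RingEquiv.refl _

/-- The canonical embedding `ι : K₀ → F` (the tree's `LocalField.padicRingHom`). [folklore] -/
def emb : PadicBase F p hp →+* F := LocalField.padicRingHom F p hp

/-- Unfolding of `emb`. [folklore] -/
theorem emb_apply (x : PadicBase F p hp) : emb hp x = LocalField.padicRingHom F p hp (toPadic hp x) :=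
  rfl

/-- `ι` is injective (a ring map out of a field). [folklore] -/
theorem emb_injective : Function.Injective (emb hp) := (emb hp).injective

/-- **The normed field structure of `K₀`**: induced from the absolute value of `F` through `ι`
(Mathlib `NormedField.induced`). [cite: SerreLocalFields1979, Ch. II §5] -/
instance instNormedField : NormedField (PadicBase F p hp) :=
  letI := nontriviallyNormedField F
  NormedField.induced (PadicBase F p hp) F (emb hp) (emb_injective hp)

/-- `‖x‖_{K₀} = ‖ι x‖_F` (by construction). [folklore] -/
theorem norm_def (x : PadicBase F p hp) :
    ‖x‖ = (letI := nontriviallyNormedField F; ‖emb hp x‖) := rfl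

/-- `F` is a `K₀`-algebra through `ι` (the canonical `ℚ_p`-algebra structure `LocalField.padicAlgebra`,
on the synonym). [folklore] -/
instance instAlgebra : Algebra (PadicBase F p hp) F := (emb hp).toAlgebra

/-- `algebraMap K₀ F = ι`. [folklore] -/
theorem algebraMap_eq (x : PadicBase F p hp) : algebraMap (PadicBase F p hp) F x = emb hp x := rfl

/-- `ι = algebraMap K₀ F` is norm-preserving. [folklore] -/
theorem norm_algebraMap (x : PadicBase F p hp) :
    (letI := nontriviallyNormedField F; ‖algebraMap (PadicBase F p hp) F x‖) = ‖x‖ := rfl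

/-- `ι : K₀ → F` is an isometry. [folklore] -/
theorem isometry_algebraMap :
    letI := nontriviallyNormedField F
    Isometry (algebraMap (PadicBase F p hp) F) := by
  letI := nontriviallyNormedField F
  exact AddMonoidHomClass.isometry_of_norm _ (norm_algebraMap hp)

/-- `ι : K₀ → F` is continuous. [folklore] -/
theorem continuous_algebraMap : Continuous (algebraMap (PadicBase F p hp) F) := by
  letI := nontriviallyNormedField F
  exact (isometry_algebraMap hp).continuous

/-- `K₀` is ultrametric (as `F` is). [folklore] -/
instance instIsUltrametricDist : IsUltrametricDist (PadicBase F p hp) := by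
  letI := nontriviallyNormedField F
  refine IsUltrametricDist.isUltrametricDist_of_forall_norm_add_le_max_norm fun x y => ?_
  rw [norm_def, norm_def, norm_def, map_add]
  exact IsUltrametricDist.norm_add_le_max _ _

/-- `‖p‖_{K₀} < 1` (`p` is the residue characteristic of `F`). [folklore] -/
theorem norm_p_lt_one : ‖(p : PadicBase F p hp)‖ < 1 := by
  rw [norm_def, map_natCast]
  exact (norm_lt_one_iff F _).mpr hp

/-- `0 < ‖p‖_{K₀}`. [folklore] -/
theorem norm_p_pos : 0 < ‖(p : PadicBase F p hp)‖ :=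
  norm_pos_iff.mpr (Nat.cast_ne_zero.mpr (Fact.out : p.Prime).ne_zero)

/-- `K₀` is nontrivially normed (`‖p‖ ∉ {0, 1}`). [folklore] -/
instance instNontriviallyNormedField : NontriviallyNormedField (PadicBase F p hp) :=
  NontriviallyNormedField.ofNormNeOne
    ⟨(p : PadicBase F p hp), Nat.cast_ne_zero.mpr (Fact.out : p.Prime).ne_zero,
      (norm_p_lt_one hp).ne⟩

/-! ### The value group: `‖x‖ = ‖p‖ ^ v_p(x)` -/

/-- `ι` maps `ℤ_p` into the valuation ring: `‖ι z‖ ≤ 1` for `z ∈ ℤ_p`. [folklore] -/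
theorem norm_coe_padicInt_le_one (z : ℤ_[p]) :
    ‖((toPadic hp).symm (z : ℚ_[p]) : PadicBase F p hp)‖ ≤ 1 := by
  letI := nontriviallyNormedField F
  rw [norm_def]
  exact (valuation_le_one_iff_norm_le_one (F := F) _).mp
    (LocalField.valuation_padicRingHom_le_one F p hp z)

/-- Units of `ℤ_p` have norm `1` in `K₀`. [folklore] -/
theorem norm_coe_units_padicInt (u : ℤ_[p]ˣ) :
    ‖((toPadic hp).symm ((u : ℤ_[p]) : ℚ_[p]) : PadicBase F p hp)‖ = 1 := by
  have h1 := norm_coe_padicInt_le_one hp (u : ℤ_[p])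
  have h2 := norm_coe_padicInt_le_one hp (u⁻¹ : ℤ_[p]ˣ)
  have hmul : ((toPadic hp).symm ((u : ℤ_[p]) : ℚ_[p]) : PadicBase F p hp) *
      (toPadic hp).symm (((u⁻¹ : ℤ_[p]ˣ) : ℤ_[p]) : ℚ_[p]) = 1 := by
    rw [← map_mul, ← PadicInt.coe_mul, Units.mul_inv, PadicInt.coe_one, map_one]
  have hn : ‖((toPadic hp).symm ((u : ℤ_[p]) : ℚ_[p]) : PadicBase F p hp)‖ *
      ‖((toPadic hp).symm (((u⁻¹ : ℤ_[p]ˣ) : ℤ_[p]) : ℚ_[p]) : PadicBase F p hp)‖ = 1 := by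
    rw [← norm_mul, hmul, norm_one]
  by_contra hne
  have hlt : ‖((toPadic hp).symm ((u : ℤ_[p]) : ℚ_[p]) : PadicBase F p hp)‖ < 1 :=
    lt_of_le_of_ne h1 hne
  have : ‖((toPadic hp).symm ((u : ℤ_[p]) : ℚ_[p]) : PadicBase F p hp)‖ *
      ‖((toPadic hp).symm (((u⁻¹ : ℤ_[p]ˣ) : ℤ_[p]) : ℚ_[p]) : PadicBase F p hp)‖ < 1 :=
    mul_lt_one_of_nonneg_of_lt_one_left (norm_nonneg _) hlt h2
  exact this.ne hn

/-- **The value group of `K₀`**: `‖x‖ = ‖p‖ ^ v_p(x)` for `x ≠ 0` (write `x = u p^v`, `u ∈ ℤ_pˣ`).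
[cite: SerreLocalFields1979, Ch. II §5] -/
theorem norm_eq_norm_p_zpow (x : PadicBase F p hp) (hx : x ≠ 0) :
    ‖x‖ = ‖(p : PadicBase F p hp)‖ ^ (toPadic hp x).valuation := by
  set v : ℤ := (toPadic hp x).valuation with hv
  have hx' : toPadic hp x ≠ 0 := hx
  -- `y := x * p^{-v}` is a unit of `ℤ_p`
  have hp0 : (p : ℚ_[p]) ≠ 0 := Nat.cast_ne_zero.mpr (Fact.out : p.Prime).ne_zero
  set y : ℚ_[p] := toPadic hp x * (p : ℚ_[p]) ^ (-v) with hy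
  have hynorm : ‖y‖ = 1 := by
    rw [hy, norm_mul, norm_zpow, Padic.norm_p, Padic.norm_eq_zpow_neg_valuation hx', ← hv,
      inv_zpow', neg_neg, ← zpow_add₀ (by exact_mod_cast (Fact.out : p.Prime).ne_zero),
      neg_add_cancel, zpow_zero]
  set z : ℤ_[p] := ⟨y, hynorm.le⟩ with hz
  have hzunit : IsUnit z := PadicInt.isUnit_iff.mpr hynorm
  obtain ⟨u, hu⟩ := hzunit
  have hxy : toPadic hp x = (u : ℤ_[p]) * (p : ℚ_[p]) ^ v := by
    rw [hu, hz]
    change toPadic hp x = y * (p : ℚ_[p]) ^ v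
    rw [hy, mul_assoc, ← zpow_add₀ hp0, neg_add_cancel, zpow_zero, mul_one]
  have hxK : x = (toPadic hp).symm ((u : ℤ_[p]) : ℚ_[p]) * (p : PadicBase F p hp) ^ v := by
    apply (toPadic hp).injective
    rw [map_mul, map_zpow₀, map_natCast, RingEquiv.apply_symm_apply]
    exact hxy
  rw [hxK, norm_mul, norm_zpow, norm_coe_units_padicInt, one_mul]

/-- `‖ι z‖ ≤ 1 ↔ z ∈ ℤ_p`: the unit ball of `K₀` is `ℤ_p`. [folklore] -/
theorem norm_le_one_iff (x : PadicBase F p hp) : ‖x‖ ≤ 1 ↔ ‖toPadic hp x‖ ≤ 1 := by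
  by_cases hx : x = 0
  · subst hx
    simp
  have hx' : toPadic hp x ≠ 0 := hx
  rw [norm_eq_norm_p_zpow hp x hx, Padic.norm_eq_zpow_neg_valuation hx']
  have hp1 : (1 : ℝ) < p := by exact_mod_cast (Fact.out : p.Prime).one_lt
  rw [zpow_le_one_iff_right_of_lt_one₀ (norm_p_pos hp) (norm_p_lt_one hp),
    zpow_le_one_iff_right₀ hp1]
  omega

/-- The embedding `ℤ_p → K₀` (coercion `ℤ_[p] → ℚ_[p]` followed by the identification). [folklore] -/
def ofPadicInt : ℤ_[p] →+* PadicBase F p hp :=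
  ((toPadic hp).symm : ℚ_[p] →+* PadicBase F p hp).comp PadicInt.Coe.ringHom

omit [TopologicalSpace F] [IsNonarchimedeanLocalField F] [CharZero F] in
/-- Unfolding of `ofPadicInt`. [folklore] -/
theorem ofPadicInt_apply (z : ℤ_[p]) : ofPadicInt hp z = (toPadic hp).symm (z : ℚ_[p]) := rfl

omit [TopologicalSpace F] [IsNonarchimedeanLocalField F] [CharZero F] in
/-- `ofPadicInt` followed by the identification with `ℚ_[p]` is the coercion. [folklore] -/
theorem toPadic_ofPadicInt (z : ℤ_[p]) : toPadic hp (ofPadicInt hp z) = (z : ℚ_[p]) := rfl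

omit [TopologicalSpace F] [IsNonarchimedeanLocalField F] [CharZero F] in
/-- `ofPadicInt` is injective. [folklore] -/
theorem ofPadicInt_injective : Function.Injective (ofPadicInt hp) := fun x y h => by
  have := congrArg (toPadic hp) h
  rw [toPadic_ofPadicInt, toPadic_ofPadicInt] at this
  exact Subtype.ext this

/-- `‖z‖_{K₀} ≤ 1` for `z ∈ ℤ_p`. [folklore] -/
theorem norm_ofPadicInt_le_one (z : ℤ_[p]) : ‖ofPadicInt hp z‖ ≤ 1 := norm_coe_padicInt_le_one hp z

/-- `‖u‖_{K₀} = 1` for `u ∈ ℤ_pˣ`. [folklore] -/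
theorem norm_ofPadicInt_units (u : ℤ_[p]ˣ) : ‖ofPadicInt hp (u : ℤ_[p])‖ = 1 :=
  norm_coe_units_padicInt hp u

/-- `‖z‖_{K₀} = ‖p‖_{K₀} ^ v_p(z)` for `z ∈ ℤ_p ∖ {0}`. [folklore] -/
theorem norm_ofPadicInt_eq (z : ℤ_[p]) (hz : z ≠ 0) :
    ‖ofPadicInt hp z‖ = ‖(p : PadicBase F p hp)‖ ^ z.valuation := by
  have hz' : ofPadicInt hp z ≠ 0 := fun h => hz (ofPadicInt_injective hp (by rw [h, map_zero]))
  rw [norm_eq_norm_p_zpow hp _ hz', toPadic_ofPadicInt, PadicInt.valuation_coe, zpow_natCast]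

/-- **Comparison of the two absolute values on `ℤ_p`**: `‖z‖_{K₀} ≤ ‖p‖_{K₀}ⁿ ↔ |z|_p ≤ p⁻ⁿ`
(both say `pⁿ ∣ z`). [folklore] -/
theorem norm_ofPadicInt_le_pow_iff (z : ℤ_[p]) (n : ℕ) :
    ‖ofPadicInt hp z‖ ≤ ‖(p : PadicBase F p hp)‖ ^ n ↔ ‖z‖ ≤ (p : ℝ) ^ (-(n : ℤ)) := by
  by_cases hz : z = 0
  · subst hz
    simp [norm_p_pos hp, pow_pos, le_of_lt]
  have hp1 : (1 : ℝ) < p := by exact_mod_cast (Fact.out : p.Prime).one_lt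
  rw [norm_ofPadicInt_eq hp z hz, pow_le_pow_iff_right_of_lt_one₀ (norm_p_pos hp) (norm_p_lt_one hp),
    PadicInt.norm_le_pow_iff_le_valuation _ hz]

/-- `‖z - 1‖_{K₀} ≤ ‖p‖ⁿ` when `z ≡ 1 (mod pⁿ)` in `ℤ_p`. [folklore] -/
theorem norm_ofPadicInt_sub_one_le {z : ℤ_[p]} {n : ℕ} (hz : ‖(z : ℤ_[p]) - 1‖ ≤ (p : ℝ) ^ (-(n : ℤ))) :
    ‖ofPadicInt hp z - 1‖ ≤ ‖(p : PadicBase F p hp)‖ ^ n := by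
  rw [← map_one (ofPadicInt hp), ← map_sub]
  exact (norm_ofPadicInt_le_pow_iff hp (z - 1) n).mpr hz

/-! ### `ι(ℚ_p)` is closed in `F`; `K₀` is complete -/

/-- The image `ι(ℤ_p) ⊆ F` is compact (`ℤ_p` is compact and `ι` is continuous for the `p`-adic
topology, tree `LocalField.continuous_padicRingHom`). [folklore] -/
theorem isCompact_image_padicInt :
    IsCompact (Set.range fun z : ℤ_[p] => LocalField.padicRingHom F p hp (z : ℚ_[p])) := by
  have hcoe : Continuous ((↑) : ℤ_[p] → ℚ_[p]) := continuous_subtype_val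
  have hc : Continuous (fun z : ℤ_[p] => LocalField.padicRingHom F p hp (z : ℚ_[p])) :=
    (LocalField.continuous_padicRingHom F p hp).comp hcoe
  haveI : CompactSpace ℤ_[p] := PadicInt.compactSpace p
  exact @isCompact_range _ _ _ _ this _ hc

/-- Every element of `ι(ℚ_p)` of absolute value `≤ ‖p‖_F⁻ⁿ` lies in `ι(p⁻ⁿ ℤ_p)`. [folklore] -/
theorem mem_image_of_norm_le (x : PadicBase F p hp) (n : ℕ)
    (hx : ‖x‖ ≤ ‖(p : PadicBase F p hp)‖ ^ (-(n : ℤ))) :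
    ∃ z : ℤ_[p], x = (toPadic hp).symm (z : ℚ_[p]) * (p : PadicBase F p hp) ^ (-(n : ℤ)) := by
  have hp0 : (p : PadicBase F p hp) ≠ 0 := Nat.cast_ne_zero.mpr (Fact.out : p.Prime).ne_zero
  -- `y := x p^n` has norm `≤ 1`
  set y : PadicBase F p hp := x * (p : PadicBase F p hp) ^ (n : ℤ) with hy
  have hynorm : ‖y‖ ≤ 1 := by
    rw [hy, norm_mul, norm_zpow]
    have hpn : 0 < ‖(p : PadicBase F p hp)‖ ^ (n : ℤ) := zpow_pos (norm_p_pos hp) _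
    calc ‖x‖ * ‖(p : PadicBase F p hp)‖ ^ (n : ℤ)
        ≤ ‖(p : PadicBase F p hp)‖ ^ (-(n : ℤ)) * ‖(p : PadicBase F p hp)‖ ^ (n : ℤ) :=
          mul_le_mul_of_nonneg_right hx hpn.le
      _ = 1 := by rw [← zpow_add₀ (norm_p_pos hp).ne', neg_add_cancel, zpow_zero]
  have hyint : ‖toPadic hp y‖ ≤ 1 := (norm_le_one_iff hp y).mp hynorm
  refine ⟨⟨toPadic hp y, hyint⟩, ?_⟩
  change x = (toPadic hp).symm (toPadic hp y) * (p : PadicBase F p hp) ^ (-(n : ℤ))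
  rw [RingEquiv.symm_apply_apply, hy, mul_assoc, ← zpow_add₀ hp0, add_neg_cancel, zpow_zero,
    mul_one]

/-- **`ι(ℚ_p)` is closed in `F`.** A convergent sequence in `ι(ℚ_p)` is bounded, hence
eventually in one of the compact sets `ι(p⁻ⁿ ℤ_p)`. [cite: SerreLocalFields1979, Ch. II §5] -/
theorem isClosed_range_algebraMap :
    IsClosed (Set.range (algebraMap (PadicBase F p hp) F)) := by
  letI := nontriviallyNormedField F
  haveI : IsUltrametricDist F := inferInstance
  -- the compact pieces `T n = ι(p)^{-n} · ι(ℤ_p)`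
  set ιp : F := algebraMap (PadicBase F p hp) F (p : PadicBase F p hp) with hιp
  have hιp0 : ιp ≠ 0 := by
    rw [hιp, map_ne_zero]; exact Nat.cast_ne_zero.mpr (Fact.out : p.Prime).ne_zero
  let T : ℕ → Set F := fun n =>
    (fun y : F => y * ιp ^ (-(n : ℤ))) ''
      Set.range (fun z : ℤ_[p] => LocalField.padicRingHom F p hp (z : ℚ_[p]))
  have hTclosed : ∀ n, IsClosed (T n) := fun n =>
    ((isCompact_image_padicInt hp).image (continuous_mul_const _)).isClosed
  have hTsub : ∀ n, T n ⊆ Set.range (algebraMap (PadicBase F p hp) F) := by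
    rintro n _ ⟨_, ⟨z, rfl⟩, rfl⟩
    refine ⟨(toPadic hp).symm (z : ℚ_[p]) * (p : PadicBase F p hp) ^ (-(n : ℤ)), ?_⟩
    rw [map_mul, map_zpow₀]
    rfl
  -- membership in `T n` from a norm bound
  have hmemT : ∀ (x : PadicBase F p hp) (n : ℕ), ‖x‖ ≤ ‖(p : PadicBase F p hp)‖ ^ (-(n : ℤ)) →
      algebraMap (PadicBase F p hp) F x ∈ T n := by
    intro x n hx
    obtain ⟨z, rfl⟩ := mem_image_of_norm_le hp x n hx
    refine ⟨LocalField.padicRingHom F p hp (z : ℚ_[p]), ⟨z, rfl⟩, ?_⟩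
    rw [map_mul, map_zpow₀]
    rfl
  -- sequential closedness
  refine IsSeqClosed.isClosed fun u x hu hux => ?_
  -- a bound `‖x‖ + 1 ≤ ‖p‖^{-n}`
  have hp1 : 1 < ‖(p : PadicBase F p hp)‖⁻¹ := one_lt_inv₀ (norm_p_pos hp) |>.mpr (norm_p_lt_one hp)
  obtain ⟨n, hn⟩ := pow_unbounded_of_one_lt (‖x‖ + 1) hp1
  have hn' : ‖x‖ + 1 < ‖(p : PadicBase F p hp)‖ ^ (-(n : ℤ)) := by
    rwa [zpow_neg, zpow_natCast, ← inv_pow]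
  -- eventually `‖u k‖ < ‖x‖ + 1`
  have hev : ∀ᶠ k in atTop, u k ∈ T n := by
    have hnorm : Tendsto (fun k => ‖u k‖) atTop (𝓝 ‖x‖) := (continuous_norm.tendsto x).comp hux
    have hlt : ∀ᶠ k in atTop, ‖u k‖ < ‖x‖ + 1 :=
      hnorm.eventually (gt_mem_nhds (by linarith))
    filter_upwards [hlt] with k hk
    obtain ⟨y, hy⟩ := hu k
    rw [← hy]
    refine hmemT y n ?_
    rw [← norm_algebraMap hp y, hy]
    exact (hk.trans hn').le
  exact hTsub n ((hTclosed n).mem_of_tendsto hux hev)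

/-- **`K₀` is complete** (`ι` is an isometry onto a closed subset of the complete field `F`).
[cite: SerreLocalFields1979, Ch. II §5] -/
instance instCompleteSpace : CompleteSpace (PadicBase F p hp) := by
  letI := nontriviallyNormedField F
  rw [completeSpace_iff_isComplete_range (isometry_algebraMap hp).isUniformInducing]
  exact (isClosed_range_algebraMap hp).isComplete

/-! ### `F` and `F̄` over `K₀` -/

/-- Scalar multiplication by `K₀` on `F` is continuous. [folklore] -/
instance instContinuousSMul : ContinuousSMul (PadicBase F p hp) F := by
  refine ⟨?_⟩
  have : (fun q : PadicBase F p hp × F => q.1 • q.2) =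
      fun q => algebraMap (PadicBase F p hp) F q.1 * q.2 := by
    funext q; exact Algebra.smul_def q.1 q.2
  rw [this]
  exact ((continuous_algebraMap hp).comp continuous_fst).mul continuous_snd

/-- **`F/ℚ_p` is finite**: a locally compact topological vector space over the complete field
`K₀` is finite-dimensional (Mathlib `FiniteDimensional.of_locallyCompactSpace`). Serre, *Local
Fields* II §5; Neukirch II (5.2). [cite: NeukirchANT1999, Ch. II (5.2)] -/
instance instFiniteDimensional : FiniteDimensional (PadicBase F p hp) F := by
  letI := nontriviallyNormedField F
  exact FiniteDimensional.of_locallyCompactSpace (PadicBase F p hp)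

/-- `F/K₀` is algebraic. [folklore] -/
instance instIsAlgebraic : Algebra.IsAlgebraic (PadicBase F p hp) F :=
  Algebra.IsAlgebraic.of_finite (PadicBase F p hp) F

/-- `F̄ = NormedAlgClosure F` is a `K₀`-algebra through `K₀ → F → F̄`. [folklore] -/
instance instAlgebraClosure : Algebra (PadicBase F p hp) (NormedAlgClosure F) :=
  ((algebraMap F (NormedAlgClosure F)).comp (algebraMap (PadicBase F p hp) F)).toAlgebra

/-- Unfolding of `algebraMap K₀ F̄`. [folklore] -/
theorem algebraMap_closure_eq (x : PadicBase F p hp) :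
    algebraMap (PadicBase F p hp) (NormedAlgClosure F) x =
      algebraMap F (NormedAlgClosure F) (algebraMap (PadicBase F p hp) F x) := rfl

/-- `K₀ → F → F̄` is a scalar tower. [folklore] -/
instance instIsScalarTowerClosure : IsScalarTower (PadicBase F p hp) F (NormedAlgClosure F) :=
  IsScalarTower.of_algebraMap_eq fun _ => rfl

/-- `F̄/K₀` is algebraic. [folklore] -/
instance instIsAlgebraicClosure : Algebra.IsAlgebraic (PadicBase F p hp) (NormedAlgClosure F) :=
  Algebra.IsAlgebraic.trans (PadicBase F p hp) F (NormedAlgClosure F)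

/-- `F̄` is an algebraic closure of `K₀`; in particular `F̄/K₀` is normal. [folklore] -/
instance instIsAlgClosureClosure : IsAlgClosure (PadicBase F p hp) (NormedAlgClosure F) where
  isAlgClosed := inferInstance
  isAlgebraic := inferInstance

/-- `F̄/K₀` is normal. [folklore] -/
instance instNormalClosure : Normal (PadicBase F p hp) (NormedAlgClosure F) := inferInstance

/-- The norm of `F̄` extends the norm of `K₀`. [folklore] -/
theorem norm_algebraMap_closure (x : PadicBase F p hp) :
    ‖algebraMap (PadicBase F p hp) (NormedAlgClosure F) x‖ = ‖x‖ := by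
  rw [algebraMap_closure_eq, NormedAlgClosure.norm_algebraMap, norm_algebraMap]

/-- `‖(p : F̄)‖ = ‖(p : K₀)‖ < 1`. [folklore] -/
theorem norm_natCast_closure : ‖(p : NormedAlgClosure F)‖ = ‖(p : PadicBase F p hp)‖ := by
  rw [← map_natCast (algebraMap (PadicBase F p hp) (NormedAlgClosure F)), norm_algebraMap_closure]

end PadicBase

end Literature.NumberTheory.PAdicHodge

end
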